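import Summits.RiemannHypothesis.RiemannHypothesis.Theorems.Splittings.NbBddNaturalThreeLines
import Summits.RiemannHypothesis.RiemannHypothesis.Theorems.NymanBeurlingNbThesis
import Mathlib.NumberTheory.LSeries.HurwitzZetaValues
import HarnessLib

/-!
# RH-EQUIVALENT·SPLITTING CENSUS (nb, neg) · V36 «SIGN»: the coefficients of Nyman–Beurling approximants cannot lie in a half-plane missing the real axis — refuted unconditionally, WITHOUT any zero of `ζ`, with an effective floor; nothing here bears on the truth of RH

LABEL (line 1): RH-EQUIVALENT·SPLITTING (cell `rh-split`, seat (nb, neg), generation 11, census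
candidate V36).  Object: the GEOMETRY (arguments / signs) of the coefficient vector `a` of a
Dirichlet polynomial `A(s) = Σ_{n<N} a_n (n+1)^{-s}` in the route's E_NB integral
`I(N,a) = ∫ |1 - ζA|²(1/2+it) dt/(1/4+t²)` (`Theses.NymanBeurling.NbThesis`, verbatim integrand).
After LENGTH (BDBLS), MASS (V34, `Splittings.NbCoefficientMass`) and SUPPORT (V35) this is the
fourth resource law of the census: SIGN.

## Results (zero definitions, standard axioms, no zero of `ζ` used)

* `sq_re_le_of_halfPlane` — HALF-PLANE LAW: if `‖u‖ = 1` and every coefficient satisfies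
  `Re(u·a_n) ≥ 0` (all `a_n` in the closed half-plane `u⁻¹·{Re ≥ 0}`), then
  `I(N,a) ≤ i ⇒ (Re u)² ≤ 27000·i`.
* `nbHalfPlane_floor` — the same as a floor: `ENNReal.ofReal ((Re u)²/27000) ≤ I(N,a)`; in
  particular (`nbPosRe_floor`, `u = 1`) every approximant with `Re a_n ≥ 0 ∀ n` has
  `I(N,a) ≥ 1/27000`, for every length `N`.
* `not_nbHalfPlaneApprox` / `not_nbPosReApprox` — the conjuncts «HALF-PLANE(u)» (`Re u ≠ 0`) and
  «POSRE» (*for every ε some approximant with coefficients in the half-plane has I < ε*) are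
  REFUTED; each trivially implies `NbThesis` (`nbThesis_of_nbHalfPlaneApprox`), so as splitting
  conjuncts they were RH-PLUS and are now dead.  The two remaining half-planes `u = ±I` contain
  the real axis; there the conjunct contains the real approximants and is RH-equivalent (not
  treated here).
* `nbNegMass_law` / `nbPosMass_law` — TWO-SIGNS LAW for ARBITRARY coefficients: every approximant
  with `I(N,a) ≤ i` carries weighted negative real mass
  `Σ_n max(-Re a_n, 0)(n+1)^{-2} ≥ 90/π⁴ - 6/π² - 50√i` and positive real mass
  `Σ_n max(Re a_n, 0)(n+1)^{-2} ≥ (6/π²)(1 - 24√i)`.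

## The argument (complete monotonicity versus `1/ζ` increasing)

The tree's point-evaluation bound `NbBddNatural.norm_nbG_le_of_re` (Cauchy formula on
`Re s > 1/2` + lossy kernel; no zeros of `ζ`) gives at a real point `x > 1`
`|1 - ζ(x)A(x)| ≤ √I · x²(x+1)²/((x-1/2)(x-1))` (`norm_one_sub_zeta_mul_dirichletPoly_le_real`),
i.e. `24√I` at `x = 2` and `(800/21)√I` at `x = 4`, where `ζ(2) = π²/6`, `ζ(4) = π⁴/90`
(Mathlib).  If `Re(u a_n) ≥ 0` for all `n`, then `x ↦ Re(u·A(x)) = Σ Re(u a_n)(n+1)^{-x}` is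
NON-INCREASING and nonnegative on the real axis, while it must be within `O(√I)` of
`Re u/ζ(x)`, which INCREASES from `x = 2` to `x = 4` when `Re u > 0` and is negative when
`Re u < 0`: both are impossible once `√I` is small, quantitatively `(Re u)² ≤ 27000·I`.
For arbitrary coefficients the same two evaluations bound the increase
`Re A(4) - Re A(2) ≥ 90/π⁴ - 6/π² - 50√I` from below, and this increase is carried entirely by
the coefficients of negative real part.

Print context: Báez-Duarte (arXiv:math/0011254, Lemma 4.2 and Remark 4.7, «inevitability of the
natural approximation») shows in Beurling's space that coefficients of pointwise-convergent
approximations tend to `μ(k)`; Landreau–Richard (Exp. Math. 11 (2002) p. 352) observe the same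
numerically for the optimal vectors and note that RH implies it.  The present file is a zero-free,
effective statement on the Dirichlet-polynomial (Báez-Duarte) side, by a different mechanism.

FILE 1/2 of V36 part A (referee carve for the gate's ≤ 400-line rule, decl text verbatim):
§§1–4 here; §§5–8 (two-signs laws, conjugation symmetry / real approximants, `u = ±I`, the
dichotomy `nbHalfPlaneApprox_iff`) continue in `Splittings.NbCoefficientSignReal` (same namespace).

HONEST LABEL: «SPLITTING SEARCH over kernel-typed RH-EQUIVALENCES; a splitting A ∧ B ⟹ RH is
CONDITIONAL bookkeeping unless A and B are both proved; nothing here bears on the truth of RH.»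
-/

set_option linter.dupNamespace false

noncomputable section

open Complex MeasureTheory Filter Topology
open scoped Real ComplexConjugate

namespace Summit.RiemannHypothesis.RiemannHypothesis.Theorems.Splittings.NbCoefficientSign

open Literature.NumberTheory.LFunctions
open Summit.RiemannHypothesis.RiemannHypothesis.Theorems.Splittings.NbBddNatural
open Summit.RiemannHypothesis.RiemannHypothesis.Theses.NymanBeurling

/-! ## 1. Dirichlet polynomials on the real axis -/

/-- `(n+1)^{-x}` is real for real `x`. -/
theorem natCast_add_one_cpow_neg_ofReal (n : ℕ) (x : ℝ) :
    ((n : ℂ) + 1) ^ (-(x : ℂ)) = ((((n : ℝ) + 1) ^ (-x) : ℝ) : ℂ) := by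
  have h0 : (0 : ℝ) ≤ (n : ℝ) + 1 := by positivity
  rw [Complex.ofReal_cpow h0 (-x)]
  push_cast
  rfl

/-- Real part of `u · A_a(x)` at a real point: `Σ Re(u a_n) (n+1)^{-x}`. -/
theorem re_mul_dirichletPoly_ofReal {N : ℕ} (u : ℂ) (a : Fin N → ℂ) (x : ℝ) :
    (u * dirichletPoly a x).re = ∑ n : Fin N, (u * a n).re * (((n : ℝ) + 1) ^ (-x)) := by
  rw [dirichletPoly_apply, Finset.mul_sum, Complex.re_sum]
  refine Finset.sum_congr rfl fun n _ ↦ ?_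
  rw [natCast_add_one_cpow_neg_ofReal, ← mul_assoc, Complex.re_mul_ofReal]

/-- `(n+1)^{-y} ≤ (n+1)^{-x}` for `x ≤ y`. -/
theorem rpow_neg_antitone (n : ℕ) {x y : ℝ} (hxy : x ≤ y) :
    ((n : ℝ) + 1) ^ (-y) ≤ ((n : ℝ) + 1) ^ (-x) := by
  have h1 : (1 : ℝ) ≤ (n : ℝ) + 1 := by
    have : (0 : ℝ) ≤ n := Nat.cast_nonneg n
    linarith
  exact Real.rpow_le_rpow_of_exponent_le h1 (by linarith)

/-- In a half-plane of coefficients, `x ↦ Re(u·A_a(x))` is non-increasing on the real axis. -/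
theorem re_mul_dirichletPoly_antitone {N : ℕ} {u : ℂ} {a : Fin N → ℂ}
    (hu : ∀ n, 0 ≤ (u * a n).re) {x y : ℝ} (hxy : x ≤ y) :
    (u * dirichletPoly a y).re ≤ (u * dirichletPoly a x).re := by
  rw [re_mul_dirichletPoly_ofReal, re_mul_dirichletPoly_ofReal]
  refine Finset.sum_le_sum fun n _ ↦ ?_
  exact mul_le_mul_of_nonneg_left (rpow_neg_antitone n hxy) (hu n)

/-- In a half-plane of coefficients, `Re(u·A_a(x)) ≥ 0` on the real axis. -/
theorem re_mul_dirichletPoly_nonneg {N : ℕ} {u : ℂ} {a : Fin N → ℂ}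
    (hu : ∀ n, 0 ≤ (u * a n).re) (x : ℝ) :
    0 ≤ (u * dirichletPoly a x).re := by
  rw [re_mul_dirichletPoly_ofReal]
  refine Finset.sum_nonneg fun n _ ↦ ?_
  exact mul_nonneg (hu n) (Real.rpow_nonneg (by positivity) _)

/-! ## 2. Point values on the real axis from the Nyman–Beurling integral (no zero of `ζ`) -/

/-- **Real point values from the distance.** For real `x > 1` and `I(N,a) ≤ i`:
`‖1 - ζ(x)A_a(x)‖ ≤ √i · x²(x+1)²/((x-1/2)(x-1))` — the tree's `norm_nbG_le_of_re` at `w = x`. -/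
theorem norm_one_sub_zeta_mul_dirichletPoly_le_real {N : ℕ} (a : Fin N → ℂ) {i : ℝ} (hi : 0 ≤ i)
    (hI : ∫⁻ t : ℝ, ENNReal.ofReal (‖1 - riemannZeta (1 / 2 + t * Complex.I) *
        ∑ n : Fin N, a n * ((n : ℂ) + 1) ^ (-(1 / 2 + t * Complex.I))‖ ^ 2 / (1 / 4 + t ^ 2)) ≤
      ENNReal.ofReal i) {x : ℝ} (hx : 1 < x) :
    ‖1 - riemannZeta x * dirichletPoly a x‖ ≤
      Real.sqrt i * (x ^ 2 * (x + 1) ^ 2 / ((x - 1 / 2) * (x - 1))) := by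
  have hxre : (1 : ℝ) / 2 < (x : ℂ).re := by simp; linarith
  have hx1 : (x : ℂ) ≠ 1 := by
    intro h
    have := congrArg Complex.re h
    simp at this; linarith
  set G : ℂ → ℂ := fun s ↦ (s - 1 - riemannZeta₁ s * dirichletPoly a s) / (s ^ 2 * (s + 1) ^ 2)
    with hGdef
  have hG : ∀ s, G s = (s - 1 - riemannZeta₁ s * dirichletPoly a s) / (s ^ 2 * (s + 1) ^ 2) :=
    fun s ↦ rfl
  have hGx : ‖G x‖ ≤ Real.sqrt i / (x - 1 / 2) := by
    have h := norm_nbG_le_of_re hxre a hG hi hI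
    simpa using h
  have hζ₁ : riemannZeta₁ x = ((x : ℂ) - 1) * riemannZeta x := by
    rw [riemannZeta_eq_inv_sub_mul hx1]; field_simp [sub_ne_zero.mpr hx1]
  have hnum : (x : ℂ) - 1 - riemannZeta₁ x * dirichletPoly a x =
      ((x : ℂ) - 1) * (1 - riemannZeta x * dirichletPoly a x) := by rw [hζ₁]; ring
  have hden : ‖(x : ℂ) ^ 2 * ((x : ℂ) + 1) ^ 2‖ = x ^ 2 * (x + 1) ^ 2 := by
    have h1 : ‖(x : ℂ)‖ = x := by rw [Complex.norm_real]; exact abs_of_pos (by linarith)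
    have h2 : ‖(x : ℂ) + 1‖ = x + 1 := by
      have : (x : ℂ) + 1 = ((x + 1 : ℝ) : ℂ) := by push_cast; ring
      rw [this, Complex.norm_real]; exact abs_of_pos (by linarith)
    rw [norm_mul, norm_pow, norm_pow, h1, h2]
  have hxm1 : ‖(x : ℂ) - 1‖ = x - 1 := by
    have : (x : ℂ) - 1 = ((x - 1 : ℝ) : ℂ) := by push_cast; ring
    rw [this, Complex.norm_real]; exact abs_of_pos (by linarith)
  have hGx' : ‖G x‖ = (x - 1) * ‖1 - riemannZeta x * dirichletPoly a x‖ / (x ^ 2 * (x + 1) ^ 2) := by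
    rw [hG, norm_div, hnum, norm_mul, hden, hxm1]
  rw [hGx'] at hGx
  have hpos : 0 < x ^ 2 * (x + 1) ^ 2 := by positivity
  have hx12 : 0 < x - 1 / 2 := by linarith
  have hx11 : 0 < x - 1 := by linarith
  rw [div_le_div_iff₀ hpos hx12] at hGx
  rw [mul_div_assoc', le_div_iff₀ (mul_pos hx12 hx11)]
  calc ‖1 - riemannZeta x * dirichletPoly a x‖ * ((x - 1 / 2) * (x - 1))
      = (x - 1) * ‖1 - riemannZeta x * dirichletPoly a x‖ * (x - 1 / 2) := by ring
    _ ≤ Real.sqrt i * (x ^ 2 * (x + 1) ^ 2) := hGx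

/-- At `x = 2` (`ζ(2) = π²/6`): `|Re u - (π²/6)·Re(u A(2))| ≤ 24√i` for `‖u‖ = 1`. -/
theorem abs_re_sub_zeta_two_mul_le {N : ℕ} (u : ℂ) (hu1 : ‖u‖ = 1) (a : Fin N → ℂ) {i : ℝ}
    (hi : 0 ≤ i)
    (hI : ∫⁻ t : ℝ, ENNReal.ofReal (‖1 - riemannZeta (1 / 2 + t * Complex.I) *
        ∑ n : Fin N, a n * ((n : ℂ) + 1) ^ (-(1 / 2 + t * Complex.I))‖ ^ 2 / (1 / 4 + t ^ 2)) ≤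
      ENNReal.ofReal i) :
    |u.re - π ^ 2 / 6 * (u * dirichletPoly a (2 : ℝ)).re| ≤ 24 * Real.sqrt i := by
  have h := norm_one_sub_zeta_mul_dirichletPoly_le_real a hi hI (x := 2) (by norm_num)
  have h2 : ((2 : ℝ) : ℂ) = 2 := by norm_num
  rw [h2, riemannZeta_two] at h
  norm_num at h
  have hmul : ‖u - (π : ℂ) ^ 2 / 6 * (u * dirichletPoly a 2)‖ ≤ 24 * Real.sqrt i := by
    have : u - (π : ℂ) ^ 2 / 6 * (u * dirichletPoly a 2) =
        u * (1 - (π : ℂ) ^ 2 / 6 * dirichletPoly a 2) := by ring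
    rw [this, norm_mul, hu1, one_mul]
    linarith
  have hre : (u - (π : ℂ) ^ 2 / 6 * (u * dirichletPoly a 2)).re =
      u.re - π ^ 2 / 6 * (u * dirichletPoly a (2 : ℝ)).re := by
    have hc : (π : ℂ) ^ 2 / 6 = ((π ^ 2 / 6 : ℝ) : ℂ) := by push_cast; ring
    rw [Complex.sub_re, hc, Complex.re_ofReal_mul, h2]
  rw [← hre]
  exact (Complex.abs_re_le_norm _).trans hmul

/-- At `x = 4` (`ζ(4) = π⁴/90`): `|Re u - (π⁴/90)·Re(u A(4))| ≤ (800/21)√i` for `‖u‖ = 1`. -/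
theorem abs_re_sub_zeta_four_mul_le {N : ℕ} (u : ℂ) (hu1 : ‖u‖ = 1) (a : Fin N → ℂ) {i : ℝ}
    (hi : 0 ≤ i)
    (hI : ∫⁻ t : ℝ, ENNReal.ofReal (‖1 - riemannZeta (1 / 2 + t * Complex.I) *
        ∑ n : Fin N, a n * ((n : ℂ) + 1) ^ (-(1 / 2 + t * Complex.I))‖ ^ 2 / (1 / 4 + t ^ 2)) ≤
      ENNReal.ofReal i) :
    |u.re - π ^ 4 / 90 * (u * dirichletPoly a (4 : ℝ)).re| ≤ 800 / 21 * Real.sqrt i := by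
  have h := norm_one_sub_zeta_mul_dirichletPoly_le_real a hi hI (x := 4) (by norm_num)
  have h4 : ((4 : ℝ) : ℂ) = 4 := by norm_num
  rw [h4, riemannZeta_four] at h
  norm_num at h
  have hmul : ‖u - (π : ℂ) ^ 4 / 90 * (u * dirichletPoly a 4)‖ ≤ 800 / 21 * Real.sqrt i := by
    have : u - (π : ℂ) ^ 4 / 90 * (u * dirichletPoly a 4) =
        u * (1 - (π : ℂ) ^ 4 / 90 * dirichletPoly a 4) := by ring
    rw [this, norm_mul, hu1, one_mul]
    linarith
  have hre : (u - (π : ℂ) ^ 4 / 90 * (u * dirichletPoly a 4)).re =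
      u.re - π ^ 4 / 90 * (u * dirichletPoly a (4 : ℝ)).re := by
    have hc : (π : ℂ) ^ 4 / 90 = ((π ^ 4 / 90 : ℝ) : ℂ) := by push_cast; ring
    rw [Complex.sub_re, hc, Complex.re_ofReal_mul, h4]
  rw [← hre]
  exact (Complex.abs_re_le_norm _).trans hmul

/-! ## 3. The half-plane law and the sign floor -/

/-- Numerical window for `ζ(2) = π²/6` and `ζ(4) = π⁴/90` from `3.14 < π < 3.15`. -/
theorem zeta_two_four_window :
    1.64326 < π ^ 2 / 6 ∧ π ^ 2 / 6 < 1.65375 ∧ 1.08012 < π ^ 4 / 90 ∧ π ^ 4 / 90 < 1.09396 := by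
  have h1 := Real.pi_gt_d2
  have h2 := Real.pi_lt_d2
  have h3 : 0 < π := Real.pi_pos
  have hl : (9.8596 : ℝ) < π ^ 2 := by nlinarith
  have hu : π ^ 2 < (9.9225 : ℝ) := by nlinarith
  have h4 : π ^ 4 = π ^ 2 * π ^ 2 := by ring
  have hp2 : 0 < π ^ 2 := by positivity
  refine ⟨?_, ?_, ?_, ?_⟩
  · linarith
  · linarith
  · rw [h4]; nlinarith [mul_lt_mul'' hl hl (by norm_num) (by norm_num)]
  · rw [h4]; nlinarith [mul_lt_mul'' hu hu hp2.le hp2.le]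

/-- **HALF-PLANE LAW (V36, zero-free, effective).** If `‖u‖ = 1`, all coefficients satisfy
`Re(u·a_n) ≥ 0`, and `I(N,a) ≤ i`, then `(Re u)² ≤ 27000·i`. -/
theorem sq_re_le_of_halfPlane {N : ℕ} (u : ℂ) (hu1 : ‖u‖ = 1) (a : Fin N → ℂ)
    (hu : ∀ n, 0 ≤ (u * a n).re) {i : ℝ} (hi : 0 ≤ i)
    (hI : ∫⁻ t : ℝ, ENNReal.ofReal (‖1 - riemannZeta (1 / 2 + t * Complex.I) *
        ∑ n : Fin N, a n * ((n : ℂ) + 1) ^ (-(1 / 2 + t * Complex.I))‖ ^ 2 / (1 / 4 + t ^ 2)) ≤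
      ENNReal.ofReal i) :
    u.re ^ 2 ≤ 27000 * i := by
  obtain ⟨hz2l, hz2u, hz4l, hz4u⟩ := zeta_two_four_window
  set z2 : ℝ := π ^ 2 / 6 with hz2
  set z4 : ℝ := π ^ 4 / 90 with hz4
  set r : ℝ := u.re with hr
  set s : ℝ := Real.sqrt i with hs
  set p2 : ℝ := (u * dirichletPoly a (2 : ℝ)).re with hp2
  set p4 : ℝ := (u * dirichletPoly a (4 : ℝ)).re with hp4
  have h2 : |r - z2 * p2| ≤ 24 * s := abs_re_sub_zeta_two_mul_le u hu1 a hi hI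
  have h4 : |r - z4 * p4| ≤ 800 / 21 * s := abs_re_sub_zeta_four_mul_le u hu1 a hi hI
  have hp2nn : 0 ≤ p2 := re_mul_dirichletPoly_nonneg hu 2
  have hp4nn : 0 ≤ p4 := re_mul_dirichletPoly_nonneg hu 4
  have hmono : p4 ≤ p2 := re_mul_dirichletPoly_antitone hu (by norm_num : (2 : ℝ) ≤ 4)
  have hs0 : 0 ≤ s := Real.sqrt_nonneg i
  have hsi : s ^ 2 = i := by rw [hs, Real.sq_sqrt hi]
  have hr1 : |r| ≤ 1 := by rw [hr, ← hu1]; exact Complex.abs_re_le_norm u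
  obtain ⟨h2a, h2b⟩ := abs_le.mp h2
  obtain ⟨h4a, h4b⟩ := abs_le.mp h4
  -- linear bound `|r| ≤ 163 s` in both sign cases
  have hlin : |r| ≤ 163 * s := by
    rcases le_or_gt 0 r with hr0 | hr0
    · rw [abs_of_nonneg hr0]
      -- `z2 (r - c4 s) ≤ z2 z4 p4 ≤ z2 z4 p2 ≤ z4 (r + c2 s)`
      have e1 : z2 * (r - 800 / 21 * s) ≤ z2 * (z4 * p4) :=
        mul_le_mul_of_nonneg_left (by linarith) (by linarith)
      have e2 : z2 * (z4 * p4) ≤ z2 * (z4 * p2) :=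
        mul_le_mul_of_nonneg_left (mul_le_mul_of_nonneg_left hmono (by linarith)) (by linarith)
      have e3 : z4 * (z2 * p2) ≤ z4 * (r + 24 * s) :=
        mul_le_mul_of_nonneg_left (by linarith) (by linarith)
      have e23 : z2 * (z4 * p2) = z4 * (z2 * p2) := by ring
      have key : r * (z2 - z4) ≤ s * (z2 * (800 / 21) + z4 * 24) := by nlinarith
      have hd : (0.5493 : ℝ) ≤ z2 - z4 := by linarith
      have hc : z2 * (800 / 21) + z4 * 24 ≤ 89.26 := by linarith
      have k1 : r * 0.5493 ≤ r * (z2 - z4) := mul_le_mul_of_nonneg_left hd hr0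
      have k2 : s * (z2 * (800 / 21) + z4 * 24) ≤ s * 89.26 := mul_le_mul_of_nonneg_left hc hs0
      nlinarith
    · rw [abs_of_neg hr0]
      have : z2 * p2 ≥ 0 := mul_nonneg (by linarith) hp2nn
      linarith
  have habs : r ^ 2 = |r| ^ 2 := (sq_abs r).symm
  rw [habs, ← hsi]
  have h0 : 0 ≤ |r| := abs_nonneg r
  nlinarith [mul_le_mul hlin hlin h0 (by linarith)]

/-- **SIGN FLOOR in a half-plane (V36).** For `‖u‖ = 1` and coefficients with `Re(u·a_n) ≥ 0`:
`I(N,a) ≥ (Re u)²/27000`, for every length `N`.  (`u = ±I`: the bound is `0`; those two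
half-planes contain the real axis.) -/
theorem nbHalfPlane_floor {N : ℕ} (u : ℂ) (hu1 : ‖u‖ = 1) (a : Fin N → ℂ)
    (hu : ∀ n, 0 ≤ (u * a n).re) :
    ENNReal.ofReal (u.re ^ 2 / 27000) ≤
      ∫⁻ t : ℝ, ENNReal.ofReal (‖1 - riemannZeta (1 / 2 + t * Complex.I) *
        ∑ n : Fin N, a n * ((n : ℂ) + 1) ^ (-(1 / 2 + t * Complex.I))‖ ^ 2 / (1 / 4 + t ^ 2)) := by
  set I := ∫⁻ t : ℝ, ENNReal.ofReal (‖1 - riemannZeta (1 / 2 + t * Complex.I) *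
        ∑ n : Fin N, a n * ((n : ℂ) + 1) ^ (-(1 / 2 + t * Complex.I))‖ ^ 2 / (1 / 4 + t ^ 2)) with hIdef
  by_cases htop : I = ⊤
  · rw [htop]; exact le_top
  have hI : I ≤ ENNReal.ofReal I.toReal := (ENNReal.ofReal_toReal htop).ge
  have h := sq_re_le_of_halfPlane u hu1 a hu ENNReal.toReal_nonneg hI
  calc ENNReal.ofReal (u.re ^ 2 / 27000) ≤ ENNReal.ofReal I.toReal := by
        apply ENNReal.ofReal_le_ofReal
        rw [div_le_iff₀ (by norm_num)]
        linarith
    _ = I := ENNReal.ofReal_toReal htop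

/-- **SIGN FLOOR (V36, `u = 1`).** Every Dirichlet polynomial whose coefficients have
nonnegative real parts has Nyman–Beurling integral `I(N,a) ≥ 1/27000`. -/
theorem nbPosRe_floor {N : ℕ} (a : Fin N → ℂ) (ha : ∀ n, 0 ≤ (a n).re) :
    ENNReal.ofReal (1 / 27000) ≤
      ∫⁻ t : ℝ, ENNReal.ofReal (‖1 - riemannZeta (1 / 2 + t * Complex.I) *
        ∑ n : Fin N, a n * ((n : ℂ) + 1) ^ (-(1 / 2 + t * Complex.I))‖ ^ 2 / (1 / 4 + t ^ 2)) := by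
  have h := nbHalfPlane_floor 1 norm_one a (by simpa using ha)
  simpa using h

/-! ## 4. The refuted conjuncts and their (trivial) RH-PLUS reading -/

/-- **V36 conjunct «HALF-PLANE(u)» REFUTED** (`‖u‖ = 1`, `Re u ≠ 0`): it is NOT the case that for
every `ε > 0` some Dirichlet polynomial with all coefficients in the half-plane `Re(u·a_n) ≥ 0`
has `I(N,a) < ε`. -/
theorem not_nbHalfPlaneApprox (u : ℂ) (hu1 : ‖u‖ = 1) (hure : u.re ≠ 0) :
    ¬ (∀ ε : ℝ, 0 < ε → ∃ (N : ℕ) (a : Fin N → ℂ), (∀ n, 0 ≤ (u * a n).re) ∧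
      ∫⁻ t : ℝ, ENNReal.ofReal (‖1 - riemannZeta (1 / 2 + t * Complex.I) *
        ∑ n : Fin N, a n * ((n : ℂ) + 1) ^ (-(1 / 2 + t * Complex.I))‖ ^ 2 / (1 / 4 + t ^ 2)) <
      ENNReal.ofReal ε) := by
  intro h
  have hε : 0 < u.re ^ 2 / 27000 := by positivity
  obtain ⟨N, a, hu, hlt⟩ := h _ hε
  exact absurd (nbHalfPlane_floor u hu1 a hu) (not_le.mpr hlt)

/-- **V36 conjunct «POSRE» REFUTED**: it is NOT the case that for every `ε > 0` some Dirichlet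
polynomial with `Re a_n ≥ 0 ∀ n` has `I(N,a) < ε`. -/
theorem not_nbPosReApprox :
    ¬ (∀ ε : ℝ, 0 < ε → ∃ (N : ℕ) (a : Fin N → ℂ), (∀ n, 0 ≤ (a n).re) ∧
      ∫⁻ t : ℝ, ENNReal.ofReal (‖1 - riemannZeta (1 / 2 + t * Complex.I) *
        ∑ n : Fin N, a n * ((n : ℂ) + 1) ^ (-(1 / 2 + t * Complex.I))‖ ^ 2 / (1 / 4 + t ^ 2)) <
      ENNReal.ofReal ε) := by
  intro h
  apply not_nbHalfPlaneApprox 1 norm_one (by norm_num)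
  intro ε hε
  obtain ⟨N, a, ha, hlt⟩ := h ε hε
  exact ⟨N, a, by simpa using ha, hlt⟩

/-- Bookkeeping: «HALF-PLANE(u)» trivially implies the route target `NbThesis` (so, before its
refutation, the splitting HALF-PLANE(u) ∧ ⊤ ⟹ RH was RH-PLUS bookkeeping). -/
theorem nbThesis_of_nbHalfPlaneApprox (u : ℂ)
    (h : ∀ ε : ℝ, 0 < ε → ∃ (N : ℕ) (a : Fin N → ℂ), (∀ n, 0 ≤ (u * a n).re) ∧
      ∫⁻ t : ℝ, ENNReal.ofReal (‖1 - riemannZeta (1 / 2 + t * Complex.I) *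
        ∑ n : Fin N, a n * ((n : ℂ) + 1) ^ (-(1 / 2 + t * Complex.I))‖ ^ 2 / (1 / 4 + t ^ 2)) <
      ENNReal.ofReal ε) :
    NbThesis := by
  intro ε hε
  obtain ⟨N, a, -, hlt⟩ := h ε hε
  exact ⟨N, a, hlt⟩

end Summit.RiemannHypothesis.RiemannHypothesis.Theorems.Splittings.NbCoefficientSign
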